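import Mathlib

/-!
# Weighted-ℓ¹ dissipativity ⇒ Grönwall decay with forcing (solo-blind s81, §24.91/24.92 (T-a), continuous form)

Companion of `SoloBlindWeightedL1Dissipativity`: there the one-sided Euler step
`|z + τ F|_ϑ ≤ (1 - τ λ + τ² β) |z|_ϑ + τ q` (small `τ > 0`) is derived from column conditions; here that
one-sided step hypothesis along a curve `z` with right derivative `F t` is turned into the Grönwall bound
`|z(t)|_ϑ ≤ gronwallBound |z(a)|_ϑ (-λ) q (t - a) = e^{-λ(t-a)} |z(a)|_ϑ + (q/λ)(1 - e^{-λ(t-a)})`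
via Mathlib's Grönwall lemma for lower-right Dini derivatives.  This is the tail estimate (T-a) of the
J-tail closure for every finite truncation, with `|·|_ϑ = Σ_m ϑ_m ‖·‖` the weighted block-ℓ¹ norm.
-/

namespace Summit.AnomalousDissipation.AnomalousDissipation.Theorems

open Finset Set Filter Topology

variable {K : ℕ} {E : Type*} [NormedAddCommGroup E]

/-- Triangle inequality for the weighted block-ℓ¹ functional. -/
theorem wl1_add_le (ϑ : Fin K → ℝ) (hϑ : ∀ m, 0 ≤ ϑ m) (u v : Fin K → E) :
    ∑ m, ϑ m * ‖(u + v) m‖ ≤ ∑ m, ϑ m * ‖u m‖ + ∑ m, ϑ m * ‖v m‖ := by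
  rw [← sum_add_distrib]
  refine sum_le_sum fun m _ => ?_
  rw [← mul_add]
  exact mul_le_mul_of_nonneg_left (by simpa using norm_add_le (u m) (v m)) (hϑ m)

/-- Positive homogeneity of the weighted block-ℓ¹ functional. -/
theorem wl1_smul [NormedSpace ℝ E] (ϑ : Fin K → ℝ) (c : ℝ) (hc : 0 ≤ c) (u : Fin K → E) :
    ∑ m, ϑ m * ‖(c • u) m‖ = c * ∑ m, ϑ m * ‖u m‖ := by
  rw [mul_sum]
  refine sum_congr rfl fun m _ => ?_
  rw [Pi.smul_apply, norm_smul, Real.norm_eq_abs, abs_of_nonneg hc]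
  ring

/-- The weighted block-ℓ¹ functional is dominated by the sup norm. -/
theorem wl1_le_sum_mul_norm (ϑ : Fin K → ℝ) (hϑ : ∀ m, 0 ≤ ϑ m) (u : Fin K → E) :
    ∑ m, ϑ m * ‖u m‖ ≤ (∑ m, ϑ m) * ‖u‖ := by
  rw [sum_mul]
  exact sum_le_sum fun m _ => mul_le_mul_of_nonneg_left (norm_le_pi_norm u m) (hϑ m)

/-- The weighted block-ℓ¹ functional is nonnegative. -/
theorem wl1_nonneg (ϑ : Fin K → ℝ) (hϑ : ∀ m, 0 ≤ ϑ m) (u : Fin K → E) :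
    0 ≤ ∑ m, ϑ m * ‖u m‖ :=
  sum_nonneg fun m _ => mul_nonneg (hϑ m) (norm_nonneg _)

/-- **Weighted-ℓ¹ one-sided step ⇒ Grönwall bound.**  Let `z : ℝ → (Fin K → E)` be continuous on `[a,b]` with
right derivative `F t` at every `t ∈ [a,b)`, and suppose the ONE-SIDED EULER STEP
`Σ ϑ_m ‖(z t + τ F t)_m‖ ≤ (1 - τ λ + τ² β) Σ ϑ_m ‖(z t)_m‖ + τ q` holds for all `t ∈ [a,b)` and `0 < τ ≤ τ₀`.
Then `Σ ϑ_m ‖(z t)_m‖ ≤ gronwallBound (Σ ϑ_m ‖(z a)_m‖) (-λ) q (t - a)` on `[a,b]`. -/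
theorem wl1_le_gronwallBound [NormedSpace ℝ E] (ϑ : Fin K → ℝ) (hϑ : ∀ m, 0 ≤ ϑ m)
    (z F : ℝ → (Fin K → E)) (a b lam β q τ₀ : ℝ) (hτ₀ : 0 < τ₀)
    (hcont : ContinuousOn z (Icc a b))
    (hder : ∀ t ∈ Ico a b, HasDerivWithinAt z (F t) (Ici t) t)
    (hstep : ∀ t ∈ Ico a b, ∀ τ ∈ Ioc (0:ℝ) τ₀,
      ∑ m, ϑ m * ‖(z t + τ • F t) m‖ ≤ (1 - τ * lam + τ ^ 2 * β) * ∑ m, ϑ m * ‖z t m‖ + τ * q) :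
    ∀ t ∈ Icc a b, ∑ m, ϑ m * ‖z t m‖ ≤ gronwallBound (∑ m, ϑ m * ‖z a m‖) (-lam) q (t - a) := by
  set f : ℝ → ℝ := fun t => ∑ m, ϑ m * ‖z t m‖ with hf
  have hfc : ContinuousOn f (Icc a b) := by
    have hW : Continuous fun w : Fin K → E => ∑ m, ϑ m * ‖w m‖ :=
      continuous_finsetSum _ fun m _ => continuous_const.mul ((continuous_apply m).norm)
    exact hW.comp_continuousOn hcont
  have hS : 0 ≤ ∑ m, ϑ m := sum_nonneg fun m _ => hϑ m
  refine le_gronwallBound_of_liminf_deriv_right_le (f := f) (f' := fun t => -lam * f t + q) hfc ?_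
    (le_refl _) (fun t _ => le_refl _)
  intro x hx r hr
  -- derivative as a limit of slopes from the right
  have hsl : Tendsto (slope z x) (𝓝[>] x) (𝓝 (F x)) := by
    have h := (hder x hx).mono (Ioi_subset_Ici_self : Ioi x ⊆ Ici x)
    exact (hasDerivWithinAt_iff_tendsto_slope' (self_notMem_Ioi : x ∉ Ioi x)).mp h
  have hfx : 0 ≤ f x := wl1_nonneg ϑ hϑ (z x)
  set gap := r - (-lam * f x + q) with hgap
  have hgap_pos : 0 < gap := by simp only [hgap]; linarith
  set ε₁ := gap / (2 * ((∑ m, ϑ m) + 1)) with hε₁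
  set ε₂ := min τ₀ (gap / (2 * (|β| * f x + 1))) with hε₂
  have hε₁_pos : 0 < ε₁ := by positivity
  have hε₂_pos : 0 < ε₂ := lt_min hτ₀ (by positivity)
  have ev1 : ∀ᶠ s in 𝓝[>] x, dist (slope z x s) (F x) < ε₁ := Metric.tendsto_nhds.mp hsl ε₁ hε₁_pos
  have ev2 : ∀ᶠ s in 𝓝[>] x, x < s := eventually_nhdsWithin_of_forall fun s hs => hs
  have ev3 : ∀ᶠ s in 𝓝[>] x, s < x + ε₂ := by
    have : ∀ᶠ s in 𝓝 x, s < x + ε₂ := Iio_mem_nhds (by linarith)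
    exact this.filter_mono nhdsWithin_le_nhds
  refine ((ev1.and (ev2.and ev3)).mono fun s hs => ?_).frequently
  obtain ⟨hd, hxs, hsx⟩ := hs
  set τ := s - x with hτdef
  have hτ : 0 < τ := by simp only [hτdef]; linarith
  have hτε : τ < ε₂ := by simp only [hτdef]; linarith
  have hττ₀ : τ ≤ τ₀ := le_trans hτε.le (min_le_left _ _)
  have hτ2 : τ ≤ gap / (2 * (|β| * f x + 1)) := le_trans hτε.le (min_le_right _ _)
  -- z s = (z x + τ • F x) + τ • (slope z x s - F x)
  have hzs : z s = (z x + τ • F x) + τ • (slope z x s - F x) := by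
    have h1 : τ • slope z x s = z s - z x := by
      simp [hτdef, sub_smul_slope]
    rw [smul_sub, h1]; abel
  have hmain : f s ≤ (1 - τ * lam + τ ^ 2 * β) * f x + τ * q + τ * ((∑ m, ϑ m) * ε₁) := by
    have hA := hstep x hx τ ⟨hτ, hττ₀⟩
    have hB : ∑ m, ϑ m * ‖(τ • (slope z x s - F x)) m‖ ≤ τ * ((∑ m, ϑ m) * ε₁) := by
      rw [wl1_smul ϑ τ hτ.le]
      refine mul_le_mul_of_nonneg_left ?_ hτ.le
      refine le_trans (wl1_le_sum_mul_norm ϑ hϑ _) (mul_le_mul_of_nonneg_left ?_ hS)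
      rw [← dist_eq_norm]; exact hd.le
    have hT := wl1_add_le ϑ hϑ (z x + τ • F x) (τ • (slope z x s - F x))
    have hfs : f s = ∑ m, ϑ m * ‖((z x + τ • F x) + τ • (slope z x s - F x)) m‖ := by
      simp only [hf]; rw [hzs]
    rw [hfs]
    linarith
  -- the two small terms are each < gap/2
  have hsmall1 : (∑ m, ϑ m) * ε₁ < gap / 2 + gap / 2 - gap / 2 := by
    have : (∑ m, ϑ m) * ε₁ = gap / 2 * ((∑ m, ϑ m) / ((∑ m, ϑ m) + 1)) := by
      simp only [hε₁]; field_simp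
    rw [this]
    have hlt : (∑ m, ϑ m) / ((∑ m, ϑ m) + 1) < 1 := by
      rw [div_lt_one (by linarith)]; linarith
    nlinarith
  have hsmall2 : τ * (|β| * f x) < gap / 2 ∨ (|β| * f x = 0) := by
    by_cases h0 : |β| * f x = 0
    · exact Or.inr h0
    · left
      have hpos : 0 < |β| * f x := lt_of_le_of_ne (mul_nonneg (abs_nonneg _) hfx) (Ne.symm h0)
      have hlt : (|β| * f x) / (|β| * f x + 1) < 1 := by
        rw [div_lt_one (by linarith)]; linarith
      calc τ * (|β| * f x) ≤ gap / (2 * (|β| * f x + 1)) * (|β| * f x) :=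
            mul_le_mul_of_nonneg_right hτ2 hpos.le
        _ = gap / 2 * ((|β| * f x) / (|β| * f x + 1)) := by field_simp
        _ < gap / 2 := by nlinarith
  -- conclude: f s - f x < τ * r
  have hβ : τ ^ 2 * β * f x ≤ τ * (τ * (|β| * f x)) := by
    have : β * f x ≤ |β| * f x := mul_le_mul_of_nonneg_right (le_abs_self β) hfx
    nlinarith [hτ.le]
  have hkey : f s - f x < τ * r := by
    rcases hsmall2 with h2 | h2
    · nlinarith [hmain, hβ, hsmall1, h2, hτ]
    · have hz : τ ^ 2 * β * f x ≤ 0 := by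
        have : |β| * f x = 0 := h2
        nlinarith [hβ, this]
      nlinarith [hmain, hsmall1, hτ, hz]
  have hinv : 0 < τ⁻¹ := inv_pos.mpr hτ
  calc (s - x)⁻¹ * (f s - f x) = τ⁻¹ * (f s - f x) := by rw [hτdef]
    _ < τ⁻¹ * (τ * r) := mul_lt_mul_of_pos_left hkey hinv
    _ = r := by field_simp

end Summit.AnomalousDissipation.AnomalousDissipation.Theorems
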